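import Summits.QuantumFields.YangMills.Theorems.LuscherReductionTwistedTraceScalingOneSiteShellGain
import Summits.QuantumFields.YangMills.Theorems.LuscherReductionOneSiteLevelsAbsLower
import Summits.QuantumFields.YangMills.Theorems.LuscherReductionOneSiteLevelsValleyReduction
import Summits.QuantumFields.YangMills.Theorems.FlatTubeReductionDressedNearTopTwoSided
import Summits.QuantumFields.YangMills.Theorems.LuscherReductionTwistedTraceScalingFPWeightIntegrand
import Summits.QuantumFields.YangMills.Theorems.LuscherReductionTwistedTraceScalingBOSupportGeometry
import Literature.Analysis.OperatorTheory.YangMillsMatrixModelAL1Holds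
import HarnessLib

/-!
# ONE-SITE ANNULUS GAIN in the currency of the TRUE one-site ground level `μ₀(B)`: `qform_B(f,f) ≤ (1 − t√t/80)·μ₀(B)·‖f‖²` for `f` vanishing on
# `{‖zmCoord 1 U‖ < t}`, `B^{−1/5} ≤ t ≤ 1/5000`, and the same for `φ` supported in the orbit annulus `{6t ≤ orbitDist₁ < 2}`
# (lane A of S-BASE, crux `TwistedTraceScaling` stmt-QuantumFields-20203, line «twolattice», stub `stub_fixedLatticeTraceLaw`; C4-SHELL; lead g23;
# card `pub/ym-fleet/ym-luscher-20007-p1/Lines-shell-gain.md`)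

The Born–Oppenheimer treatment of the C4-SHELL (`ShellGainOneOrbitAt`, ✓`…ShellOneOrbit`; COARSE-DESIGN §22.4–§22.6) reduces the lattice form on a thin exponent-shell to the
ONE-SITE form at coupling `B = L³β` of slow functions supported in a one-site orbit annulus, compares with `σ·μ₀(B)` through the record floor `e^{−ελ_b/4}σμ₀ ≤ λ₀`, and so needs
the one-site annulus gain RELATIVE TO `μ₀(B) = levelValue su2Rep 1 B 0`, not relative to the top value `linkCE B` of ✓`oneSite_shell_gain`.  This file supplies it:
* `linkCE_exp_le_levelValue_one_zero` — crux ONE's quasimode floor at `k = 0` in `linkCE` form: `∃ C B₀, ∀ B ≥ B₀, linkCE B·e^{−E₁λ_b − Cλ_b²} ≤ μ₀(B)`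
  (✓`oneSiteAbsLower_of_eigenfunctions` ∘ ✓`LuscherHamiltonianEigenfunctions_holds 0`, `E₁ = physLevel 1`);
* `exp_mul_one_sub_le` — `e^x(1 − g) ≤ 1 − g/2` for `0 ≤ g ≤ 1`, `0 ≤ x`, `4x ≤ g`;
* `rpow_neg_fifth_mul_sqrt` / `mul_sqrt_ge_of_ge` — `t√t ≥ B^{−3/10}` for `t ≥ B^{−1/5}`;
* ★★ `oneSite_annulus_gain` — `∃ B₀, ∀ B ≥ B₀, ∀ t ∈ [B^{−1/5}, 1/5000]`, every bounded measurable `f` with `f = 0` on `{‖zmCoord 1 U‖ < t}`: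
  `qform su2Rep B f f ≤ (1 − t√t/80)·levelValue su2Rep 1 B 0·l2 f f` (the `O(λ_b) = O(B^{−1/3})` price of passing from `linkCE` to `μ₀` is half the gain `t√t/40 ≥ B^{−3/10}/40`,
  eventually, by ✓`mul_bareLambda_le_gain` at exponent `3/10 < 1/3`);
* `scalarPart_pos_of_orbitDist_lt_two`, `zmCoord_support_of_orbit_annulus` — a one-site `φ` supported in `{6t ≤ orbitDist} ∩ {orbitDist < 2}` vanishes on `{‖zmCoord 1‖ < t}`
  (✓`orbitDist_le_six_norm_zmCoord_of_upper`, ✓`scalarPart_pos_of_frobNorm_lt_two`, ✓`frobNorm_sub_one_le_orbitDist`);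
* ★★ `oneSite_annulus_gain_orbitDist` — the same gain for bounded measurable `φ` supported in the orbit annulus `{6t ≤ orbitDist u} ∩ {orbitDist u < 2}` — the currency in which
  the BO slow functions of the thin shell arrive (`orbitDist` of the slow mean).
HONEST FRAMING: a one-site (L = 1) estimate, an ingredient of C4-SHELL of the CONDITIONAL fixed-lattice programme (route R2b1); the shell, COARSE-UPPER/LOWER/TAIL, the stubs and
the crux stay OPEN; not infinite volume, not a mass gap, not Clay.  No definitions, no `sorry`.
-/

set_option autoImplicit false

noncomputable section

open MeasureTheory Filter Topology Real
open scoped BigOperators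
open Literature.MathematicalPhysics.QuantumFieldTheory
open Literature.MathematicalPhysics.QuantumLattice
open Literature.Analysis.OperatorTheory.YMMatrixModel

namespace Summit.QuantumFields.YangMills.Theorems.FemtoTransferGap

open Summit.QuantumFields.YangMills.Theorems.FemtoTransferGap.TwoLattice.ConstTube
open Summit.QuantumFields.YangMills.Theorems.FemtoTransferGap.RateTube

/-! ## §1 Crux ONE's floor at `k = 0` in `linkCE` form -/

/-- **`linkCE B·e^{−E₁λ_b − Cλ_b²} ≤ μ₀(B)` eventually in `B`** (`E₁ = physLevel 1`; crux ONE's quasimode half at `k = 0`). [cite: Luscher1983, §2–§3] [cite: ReedSimonIV1978, Thm. XIII.1] -/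
theorem linkCE_exp_le_levelValue_one_zero :
    ∃ C B0 : ℝ, ∀ B : ℝ, B0 ≤ B → linkCE B * Real.exp (-(physLevel 1 * bareLambda B) - C * bareLambda B ^ 2) ≤ levelValue su2Rep 1 B 0 := by
  obtain ⟨C, B0, h⟩ := oneSiteAbsLower_of_eigenfunctions (LuscherHamiltonianEigenfunctions_holds 0)
  refine ⟨C, B0, fun B hB => ?_⟩
  have hCE : linkCE B = linkC B ^ 3 := by rw [linkCE, card_edge_one]
  rw [hCE]
  simpa using h B hB

/-- **`linkCE B ≤ μ₀(B)·e^{Kλ_b}` eventually**, `K = physLevel 1 + |C| ≥ 0` (for `λ_b ≤ 1`). [folklore] -/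
theorem linkCE_le_levelValue_mul_exp :
    ∃ K B0 : ℝ, 0 ≤ K ∧ ∀ B : ℝ, B0 ≤ B → linkCE B ≤ levelValue su2Rep 1 B 0 * Real.exp (K * bareLambda B) := by
  obtain ⟨C, B0, h⟩ := linkCE_exp_le_levelValue_one_zero
  have hE1 : 0 ≤ physLevel 1 := physLevel_nonneg le_rfl
  refine ⟨physLevel 1 + |C|, max B0 2, by positivity, fun B hB => ?_⟩
  have hB0 : B0 ≤ B := (le_max_left _ _).trans hB
  have hB2 : 2 ≤ B := (le_max_right _ _).trans hB
  have hBpos : 0 < B := by linarith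
  have hlam0 : 0 ≤ bareLambda B := by unfold bareLambda; positivity
  have hlam1 : bareLambda B ≤ 1 := by
    unfold bareLambda
    exact Real.rpow_le_one (by positivity) ((div_le_one hBpos).2 hB2) (by norm_num)
  have h1 := h B hB0
  -- `e^{−E₁λ − Cλ²}·e^{Kλ} ≥ 1`
  have hexp : 1 ≤ Real.exp (-(physLevel 1 * bareLambda B) - C * bareLambda B ^ 2) * Real.exp ((physLevel 1 + |C|) * bareLambda B) := by
    rw [← Real.exp_add]
    refine Real.one_le_exp ?_
    have hsq : bareLambda B ^ 2 ≤ bareLambda B := by nlinarith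
    have hC : -(C * bareLambda B ^ 2) ≥ -(|C| * bareLambda B) := by
      have h2 : C * bareLambda B ^ 2 ≤ |C| * bareLambda B ^ 2 := mul_le_mul_of_nonneg_right (le_abs_self C) (sq_nonneg _)
      have h3 : |C| * bareLambda B ^ 2 ≤ |C| * bareLambda B := mul_le_mul_of_nonneg_left hsq (abs_nonneg C)
      linarith
    nlinarith
  have hCE0 : 0 ≤ linkCE B := (linkCE_pos hBpos.le).le
  calc linkCE B = linkCE B * 1 := by ring
    _ ≤ linkCE B * (Real.exp (-(physLevel 1 * bareLambda B) - C * bareLambda B ^ 2) * Real.exp ((physLevel 1 + |C|) * bareLambda B)) :=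
        mul_le_mul_of_nonneg_left hexp hCE0
    _ = (linkCE B * Real.exp (-(physLevel 1 * bareLambda B) - C * bareLambda B ^ 2)) * Real.exp ((physLevel 1 + |C|) * bareLambda B) := by ring
    _ ≤ levelValue su2Rep 1 B 0 * Real.exp ((physLevel 1 + |C|) * bareLambda B) := mul_le_mul_of_nonneg_right h1 (Real.exp_pos _).le

/-! ## §2 Real-number lemmas -/

/-- `e^x(1 − g) ≤ 1 − g/2` for `0 ≤ g ≤ 1`, `0 ≤ x`, `4x ≤ g`. [folklore] -/
theorem exp_mul_one_sub_le {x g : ℝ} (hg0 : 0 ≤ g) (hg1 : g ≤ 1) (hx0 : 0 ≤ x) (hx : 4 * x ≤ g) : Real.exp x * (1 - g) ≤ 1 - g / 2 := by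
  have hx1 : x ≤ 1 := by linarith
  have habs : |x| ≤ 1 := by rw [abs_of_nonneg hx0]; exact hx1
  have h1 := Real.abs_exp_sub_one_sub_id_le habs
  rw [abs_le] at h1
  have h2 : Real.exp x ≤ 1 + 2 * x := by nlinarith [h1.2]
  have h3 : Real.exp x * (1 - g) ≤ (1 + 2 * x) * (1 - g) := mul_le_mul_of_nonneg_right h2 (by linarith)
  nlinarith [h3]

/-- `√(B^{−1/5}) = B^{−1/10}` for `B ≥ 0`. [folklore] -/
theorem sqrt_rpow_neg_fifth {B : ℝ} (hB : 0 ≤ B) : Real.sqrt (B ^ (-(1 / 5 : ℝ))) = B ^ (-(1 / 10 : ℝ)) := by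
  rw [Real.sqrt_eq_rpow, ← Real.rpow_mul hB]
  norm_num

/-- `B^{−3/10} ≤ t√t` for `t ≥ B^{−1/5}`, `B > 0`. [folklore] -/
theorem rpow_neg_three_tenths_le_mul_sqrt {B t : ℝ} (hB : 0 < B) (ht : B ^ (-(1 / 5 : ℝ)) ≤ t) : B ^ (-(3 / 10 : ℝ)) ≤ t * Real.sqrt t := by
  have h15 : 0 < B ^ (-(1 / 5 : ℝ)) := Real.rpow_pos_of_pos hB _
  have ht0 : 0 ≤ t := h15.le.trans ht
  have hs : Real.sqrt (B ^ (-(1 / 5 : ℝ))) ≤ Real.sqrt t := Real.sqrt_le_sqrt ht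
  rw [sqrt_rpow_neg_fifth hB.le] at hs
  have h110 : 0 ≤ B ^ (-(1 / 10 : ℝ)) := (Real.rpow_pos_of_pos hB _).le
  have e : B ^ (-(3 / 10 : ℝ)) = B ^ (-(1 / 5 : ℝ)) * B ^ (-(1 / 10 : ℝ)) := by
    rw [← Real.rpow_add hB]; norm_num
  rw [e]
  exact mul_le_mul ht hs h110 ht0

/-! ## §3 The annulus gain in `μ₀`-currency -/

/-- ★★ **ONE-SITE ANNULUS GAIN relative to `μ₀(B)`.**  There is `B₀` such that for `B ≥ B₀` and every radius `t` with `B^{−1/5} ≤ t ≤ 1/5000`, every bounded measurable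
one-site function `f` vanishing on `{‖zmCoord 1 U‖ < t}` satisfies `qform_B(f,f) ≤ (1 − t√t/80) · μ₀(B) · ‖f‖²`, `μ₀(B) = levelValue su2Rep 1 B 0`.
(✓`oneSite_shell_gain` gives the gain `t√t/40` against `linkCE B`; crux ONE's floor `linkCE ≤ μ₀e^{Kλ_b}` costs `Kλ_b ≤ B^{−3/10}/160 ≤ t√t/160` eventually.)
[cite: SimonB1983DiscreteSpectrum, §2] [cite: Luscher1983, §2–§3] -/
theorem oneSite_annulus_gain : ∃ B₀ : ℝ, ∀ B : ℝ, B₀ ≤ B → ∀ t : ℝ, B ^ (-(1 / 5 : ℝ)) ≤ t → t ≤ 1 / 5000 →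
    ∀ f : Cfg → ℝ, Measurable f → (∃ C : ℝ, ∀ U, |f U| ≤ C) → (∀ U, ‖zmCoord 1 U‖ < t → f U = 0) →
      qform su2Rep B f f ≤ (1 - t * Real.sqrt t / 80) * levelValue su2Rep 1 B 0 * l2 f f := by
  obtain ⟨B₁, hgain⟩ := oneSite_shell_gain
  obtain ⟨K, B₂, hK0, hfloor⟩ := linkCE_le_levelValue_mul_exp
  obtain ⟨T, hT1, hT⟩ := mul_bareLambda_le_gain (c₀ := 1 / 160) (a := 3 / 10) (by norm_num) (by norm_num) K
  refine ⟨max (max B₁ B₂) T, fun B hB t htB ht f hfm hfb hf0 => ?_⟩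
  have hB₁ : B₁ ≤ B := ((le_max_left _ _).trans (le_max_left _ _)).trans hB
  have hB₂ : B₂ ≤ B := ((le_max_right _ _).trans (le_max_left _ _)).trans hB
  have hBT : T ≤ B := (le_max_right _ _).trans hB
  have hBpos : 0 < B := by linarith
  -- sizes
  have h15 : 0 < B ^ (-(1 / 5 : ℝ)) := Real.rpow_pos_of_pos hBpos _
  have ht0 : 0 < t := lt_of_lt_of_le h15 htB
  have hst : t * Real.sqrt t ≤ 1 := by
    have h1 : Real.sqrt t ≤ 1 := Real.sqrt_le_one.mpr (by linarith) |>.trans le_rfl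
    nlinarith [Real.sqrt_nonneg t]
  have hst0 : 0 ≤ t * Real.sqrt t := by positivity
  set g : ℝ := t * Real.sqrt t / 40 with hg
  have hg0 : 0 ≤ g := by positivity
  have hg1 : g ≤ 1 := by rw [hg]; linarith
  -- `4Kλ ≤ g`
  have hx : 4 * (K * bareLambda B) ≤ g := by
    have h1 := hT B hBT
    have h2 := rpow_neg_three_tenths_le_mul_sqrt hBpos htB
    rw [hg]; linarith
  have hlam0 : 0 ≤ bareLambda B := by unfold bareLambda; positivity
  have hx0 : 0 ≤ K * bareLambda B := mul_nonneg hK0 hlam0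
  -- the two inputs
  have hq := hgain B hB₁ t htB ht f hfm hfb hf0
  have hfl := hfloor B hB₂
  have hμ0 : 0 ≤ levelValue su2Rep 1 B 0 := (levelValue_su2Rep_pos (L := 1) hBpos 0).le
  have hl2 : 0 ≤ l2 f f := l2_self_nonneg_lat (L := 1) f
  have h1g : 0 ≤ 1 - t * Real.sqrt t / 40 := by linarith
  -- `linkCE(1−g) ≤ μ₀ e^{Kλ}(1−g) ≤ μ₀(1 − g/2)`
  have hkey : linkCE B * (1 - t * Real.sqrt t / 40) ≤ (1 - t * Real.sqrt t / 80) * levelValue su2Rep 1 B 0 := by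
    have h2 : linkCE B * (1 - t * Real.sqrt t / 40) ≤ levelValue su2Rep 1 B 0 * Real.exp (K * bareLambda B) * (1 - t * Real.sqrt t / 40) :=
      mul_le_mul_of_nonneg_right hfl h1g
    have h3 := exp_mul_one_sub_le hg0 hg1 hx0 hx
    have h4 : levelValue su2Rep 1 B 0 * (Real.exp (K * bareLambda B) * (1 - g)) ≤ levelValue su2Rep 1 B 0 * (1 - g / 2) :=
      mul_le_mul_of_nonneg_left h3 hμ0
    have e1 : (1 : ℝ) - t * Real.sqrt t / 40 = 1 - g := by rw [hg]
    have e2 : (1 : ℝ) - t * Real.sqrt t / 80 = 1 - g / 2 := by rw [hg]; ring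
    rw [e1, e2]
    calc linkCE B * (1 - g) ≤ levelValue su2Rep 1 B 0 * Real.exp (K * bareLambda B) * (1 - g) := by rw [← e1]; exact h2
      _ = levelValue su2Rep 1 B 0 * (Real.exp (K * bareLambda B) * (1 - g)) := by ring
      _ ≤ levelValue su2Rep 1 B 0 * (1 - g / 2) := h4
      _ = (1 - g / 2) * levelValue su2Rep 1 B 0 := by ring
  calc qform su2Rep B f f ≤ linkCE B * (1 - t * Real.sqrt t / 40) * l2 f f := hq
    _ ≤ (1 - t * Real.sqrt t / 80) * levelValue su2Rep 1 B 0 * l2 f f := mul_le_mul_of_nonneg_right hkey hl2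

/-! ## §4 The same in the orbit-annulus currency -/

/-- A one-site configuration within `orbitDist < 2` of the vacuum orbit has all links in the open upper hemisphere. [folklore] -/
theorem scalarPart_pos_of_orbitDist_lt_two {u : GaugeConfig 3 1 SU2} (hu : orbitDist u < 2) (e : Edge 3 1) : 0 < scalarPart (u e) :=
  scalarPart_pos_of_frobNorm_lt_two (lt_of_le_of_lt (frobNorm_sub_one_le_orbitDist u e) hu)

/-- A one-site function supported in the orbit annulus `{6t ≤ orbitDist} ∩ {orbitDist < 2}` vanishes on `{‖zmCoord 1 U‖ < t}`. [folklore] -/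
theorem zmCoord_support_of_orbit_annulus {t : ℝ} {φ : GaugeConfig 3 1 SU2 → ℝ}
    (hφ : ∀ u, φ u ≠ 0 → 6 * t ≤ orbitDist u ∧ orbitDist u < 2) (U : GaugeConfig 3 1 SU2) (hU : ‖zmCoord 1 U‖ < t) : φ U = 0 := by
  by_contra hne
  obtain ⟨h6, h2⟩ := hφ U hne
  have hup := orbitDist_le_six_norm_zmCoord_of_upper (scalarPart_pos_of_orbitDist_lt_two h2)
  linarith

/-- ★★ **ONE-SITE ANNULUS GAIN in `orbitDist` currency.**  There is `B₀` such that for `B ≥ B₀` and `B^{−1/5} ≤ t ≤ 1/5000`, every bounded measurable one-site `φ` supported in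
the orbit annulus `{6t ≤ orbitDist u} ∩ {orbitDist u < 2}` satisfies `qform_B(φ,φ) ≤ (1 − t√t/80) · μ₀(B) · ‖φ‖²`. [cite: SimonB1983DiscreteSpectrum, §2] [cite: Luscher1983, §2–§3] -/
theorem oneSite_annulus_gain_orbitDist : ∃ B₀ : ℝ, ∀ B : ℝ, B₀ ≤ B → ∀ t : ℝ, B ^ (-(1 / 5 : ℝ)) ≤ t → t ≤ 1 / 5000 →
    ∀ φ : GaugeConfig 3 1 SU2 → ℝ, Measurable φ → (∃ C : ℝ, ∀ u, |φ u| ≤ C) →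
      (∀ u, φ u ≠ 0 → 6 * t ≤ orbitDist u ∧ orbitDist u < 2) →
        qform su2Rep B φ φ ≤ (1 - t * Real.sqrt t / 80) * levelValue su2Rep 1 B 0 * l2 φ φ := by
  obtain ⟨B₀, h⟩ := oneSite_annulus_gain
  exact ⟨B₀, fun B hB t htB ht φ hφm hφb hφs => h B hB t htB ht φ hφm hφb (zmCoord_support_of_orbit_annulus hφs)⟩

end Summit.QuantumFields.YangMills.Theorems.FemtoTransferGap

end
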